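import Literature.Computability.AlgebraicComplexity.RazElusiveGeneralRoute
import Literature.Computability.AlgebraicComplexity.GateQuotients
import HarnessLib

/-!
# Raz 2010, Cor. 5.7: the universal-circuit argument (discharge of `Raz2010_cor_5_7`)

Companion to `RazElusiveGeneralRoute.lean`, which vendors Raz's Corollary 5.7 as the named fact
`Raz2010_cor_5_7` (nothing asserted there). This file PROVES it
(`Raz2010_cor_5_7_holds`), following the printed route (Raz 2010, §2.3 and §5):

* **Prop. 2.7 (reduction to normal-depth-4 form), structural core.** If a homogeneous
  polynomial `g` of degree `r ≥ 3` is computed by a fan-in-two circuit with at most `L` gates,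
  then `g = ∑_t A_t · B_t` over at most `L · (r + 1)` slots `t`, with `deg A_t, deg B_t ≤ r'`,
  `r' = ⌊2r/3⌋` (`exists_sum_mul_of_circuit`). Raz proves this by induction on the homogenized
  circuit, removing one node of syntactic degree in `(r/3, 2r/3]` at a time
  ("`g = g₀ + P · Q`", p. 153). Here the same bookkeeping is run directly on the tree's
  (non-homogeneous) straight-line circuits (`ArithCircuit`, total fold semantics): along the
  list of gate values, every homogeneous component of degree `j > r/3` of every gate value lies
  in the ideal spanned by the homogeneous components of degree `d ∈ (r/3, 2r/3]` of the gate
  values (`midGood_gateValues`; the product case is the Cauchy formula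
  `[uw]_j = ∑_i [u]_i [w]_{j-i}`, in which one factor always has degree `> r/3` because
  `j > 2r/3` — this is where fan-in two and `r ≥ 3` enter, exactly as in print), and membership
  of the degree-`r` form `g` in an ideal spanned by forms is witnessed in degree `r`.
* **Props. 5.1–5.3 (the universal polynomial mapping `Γ_G` of degree `2`).** The universal
  polynomial `U = ∑_t (∑_b y_{t,0,b} z^b)(∑_b y_{t,1,b} z^b)`, `b` over the monomials of degree
  `≤ r'` (`universalPoly`), has `z^M`-coefficients of degree `≤ 2` in the labels `y`
  (`totalDegree_coeff_universalPoly_le`, Prop. 5.2), and evaluating the labels at the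
  coefficient vectors of `(A_t, B_t)` returns the coefficients of `∑_t A_t B_t`
  (`eval_coeff_universalPoly`, Prop. 5.1). Hence `H(g) ∈ Image(Γ)` for every degree-`r` form
  `g` of complexity `≤ L`, with `Γ` of degree `2` in
  `N ≤ 4 · C(n+r'-1, r') · r³ · (L + n)` variables (`exists_universal_map`, Prop. 5.3; the
  count is `L (r+1) · 2 · #{monomials of degree ≤ r'} ≤ 4 r² L · C(n+r'-1, r')`).
* **Prop. 5.6 / Cor. 5.7.** Over the extension field `G`: `f(a) = H(f̃|_a)` (Prop. 5.4,
  `lexCoeffs_razTildeAt`), `f̃|_a` is a projection of `f̃` (`isProjection_razTildeAt`, so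
  `L(f̃|_a) ≤ L(f̃)`, projections being free), and a circuit over `F` for `f̃` is a circuit over
  `G` for it (`complexity_map_le`, `map_razTilde`). So if `s > 4 · C(n+r'-1,r') · r³ · (L + n)`,
  `L = L_F(f̃)`, then `Image(f) ⊆ Image(Γ)` with `Γ : G^N → G^m` of degree `2` and `N ≤ s`,
  contradicting `(s, 2)`-elusiveness (`IsElusive.anti_left`). The constant of the fact's
  `∃ c` is `c = 4`.

Nothing new is asserted: no named facts are introduced; all intermediate results are proved.
The change-of-coefficients lemmas for circuits (`ArithCircuit.map`) are private twins of the
public ones in `RealTauConjectureDepthFour.lean` (same statements and proofs), kept private here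
to avoid that module's import cone (Koiran–Tavenas, counting hierarchy).

## References

* R. Raz, *Elusive functions and lower bounds for arithmetic circuits*, Theory of Computing 6
  (2010) 135–177, doi:10.4086/toc.2010.v006a007: Def. 2.6 and Prop. 2.7 (pp. 151–154), §5.1–5.2
  (Props. 5.1–5.3, pp. 168–170), §5.3 (Prop. 5.4), §5.4 (Prop. 5.6, Cor. 5.7, pp. 171–172).
* P. Bürgisser, *Completeness and reduction in algebraic complexity theory* (2000), Def. 2.1,
  Rem. 2.7, §4.1 (straight-line programs, projections, extension of scalars).
-/

noncomputable section

open MvPolynomial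

namespace Literature.Computability.AlgebraicComplexity

universe u v w

/-! ### Circuits under a change of coefficients (Bürgisser 2000, §4.1) -/

namespace ArithCircuit

variable {k : Type u} {k' : Type w} {σ : Type v}

/-- A change of coefficients does not change the size (private twin of `size_map`,
`RealTauConjectureDepthFour.lean`). [cite: Burgisser2000, §4.1] -/
private theorem size_map_aux [CommSemiring k] [CommSemiring k'] (φ : k →+* k')
    (P : ArithCircuit k σ) : (P.map φ).size = P.size := by
  simp [ArithCircuit.map, size]

/-- A change of coefficients does not change the fan-in of a gate (private twin of
`Gate.fanIn_map`). [cite: Burgisser2000, §4.1] -/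
private theorem fanIn_map_aux (φ : k → k') (g : Gate k σ) : (g.map φ).fanIn = g.fanIn := by
  cases g <;> simp [Gate.map, Gate.fanIn, Gate.args]

/-- A change of coefficients preserves fan-in two (private twin of `IsFanInTwo.map`).
[cite: Burgisser2000, §4.1] -/
private theorem isFanInTwo_map_aux [CommSemiring k] [CommSemiring k'] {P : ArithCircuit k σ}
    (hP : P.IsFanInTwo) (φ : k →+* k') : (P.map φ).IsFanInTwo := by
  intro g hg
  simp only [ArithCircuit.map, List.mem_map] at hg
  obtain ⟨g', hg', rfl⟩ := hg
  rw [fanIn_map_aux]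
  exact hP g' hg'

variable [CommSemiring k] [CommSemiring k']

/-- A mapped operand, read against the mapped value list, evaluates to the mapped value
(private twin of `Operand.eval_map`). [cite: Burgisser2000, §4.1] -/
private theorem operand_eval_map_aux (φ : k →+* k') (vals : List (MvPolynomial σ k))
    (u : Operand k σ) :
    (u.map φ).eval (vals.map (MvPolynomial.map φ)) = MvPolynomial.map φ (u.eval vals) := by
  cases u with
  | var i => simp [Operand.map, Operand.eval]
  | const c => simp [Operand.map, Operand.eval]
  | gate j =>
    simp only [Operand.map, Operand.eval, List.getD_eq_getElem?_getD, List.getElem?_map]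
    cases vals[j]? <;> simp

/-- A mapped gate, read against the mapped value list, evaluates to the mapped value
(private twin of `Gate.eval_map`). [cite: Burgisser2000, §4.1] -/
private theorem gate_eval_map_aux (φ : k →+* k') (vals : List (MvPolynomial σ k))
    (g : Gate k σ) :
    (g.map φ).eval (vals.map (MvPolynomial.map φ)) = MvPolynomial.map φ (g.eval vals) := by
  cases g with
  | sum args =>
    simp only [Gate.map, Gate.eval, List.map_map, map_list_sum]
    congr 1
    simp [Function.comp_def, operand_eval_map_aux, MvPolynomial.smul_eq_C_mul, map_C]
  | prod args =>
    simp only [Gate.map, Gate.eval, List.map_map, map_list_prod]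
    congr 1
    simp [Function.comp_def, operand_eval_map_aux]

/-- The value list of a mapped gate list is the mapped value list (private twin of
`gateValues_map`). [cite: Burgisser2000, §4.1] -/
private theorem gateValues_map_aux (φ : k →+* k') (gs : List (Gate k σ)) :
    gateValues (gs.map (Gate.map φ)) = (gateValues gs).map (MvPolynomial.map φ) := by
  induction gs using List.reverseRecOn with
  | nil => rfl
  | append_singleton gs g ih =>
    rw [List.map_append, List.map_singleton, gateValues_append_singleton,
      gateValues_append_singleton, ih, gate_eval_map_aux, List.map_append, List.map_singleton]

/-- Change of coefficients maps the computed polynomial (private twin of `eval_map_apply`).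
[cite: Burgisser2000, §4.1] -/
private theorem eval_map_aux (φ : k →+* k') (P : ArithCircuit k σ) :
    (P.map φ).eval = MvPolynomial.map φ P.eval := by
  change (P.output.map φ).eval (gateValues (P.gates.map (Gate.map φ))) = _
  rw [gateValues_map_aux, operand_eval_map_aux]
  rfl

/-- **Extension of scalars is free**: `L_{k'}(φ f) ≤ L_k(f)` for every ring homomorphism
`φ : k → k'` — map every constant and coefficient of a minimal circuit along `φ` (Bürgisser
2000, §4.1; Raz 2010, proof of Prop. 5.6: "any arithmetic circuit over `F` is in particular an
arithmetic circuit over `G`"). [cite: Raz2010, Prop. 5.6 (p. 172), proof] -/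
theorem complexity_map_le (φ : k →+* k') (p : MvPolynomial σ k) :
    complexity (MvPolynomial.map φ p) ≤ complexity p := by
  obtain ⟨P, h1, h2, h3⟩ := exists_computes_size_eq_complexity p
  rw [← h3, ← size_map_aux φ P]
  refine complexity_le_size (isFanInTwo_map_aux h1 φ) ?_
  unfold Computes at h2 ⊢
  rw [eval_map_aux, h2]

end ArithCircuit

/-! ### Prop. 2.7, structural core: `g = ∑ A_t B_t` with `deg A_t, deg B_t ≤ ⌊2r/3⌋` -/

section Structure

variable {K : Type u} [CommSemiring K] {σ : Type v}

open ArithCircuit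

/-- The generators: homogeneous components of "middle" degree `d`, `r/3 < d ≤ 2r/3`, of the
listed gate values (Raz 2010, proof of Prop. 2.7: the nodes "of syntactic-degree larger than
`r/3` and smaller or equal to `2r/3`"). [cite: Raz2010, Prop. 2.7 (p. 152), proof] -/
private def midGens (r : ℕ) (vals : List (MvPolynomial σ K)) : Set (MvPolynomial σ K) :=
  {p | ∃ v ∈ vals, ∃ d : ℕ, (r < 3 * d ∧ 3 * d ≤ 2 * r) ∧ p = homogeneousComponent d v}

/-- More gate values, more generators. [cite: Raz2010, Prop. 2.7 (p. 152), proof] -/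
private theorem midGens_mono (r : ℕ) {vals ws : List (MvPolynomial σ K)} (h : vals ⊆ ws) :
    midGens (K := K) r vals ⊆ midGens r ws :=
  fun _ ⟨v, hv, d, hd, hp⟩ => ⟨v, h hv, d, hd, hp⟩

/-- The invariant of the induction: every homogeneous component of degree `j > r/3` of every
listed gate value lies in the ideal spanned by the middle components (for middle `j` it is a
generator; for `j > 2r/3` this is the content of "`g = g₀ + P · Q`" iterated, Raz 2010,
p. 153). [cite: Raz2010, Prop. 2.7 (p. 153), proof] -/
private def MidGood (r : ℕ) (vals : List (MvPolynomial σ K)) : Prop :=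
  ∀ v ∈ vals, ∀ j : ℕ, r < 3 * j → homogeneousComponent j v ∈ Ideal.span (midGens r vals)

/-- Operands: a variable or a constant has no component of degree `j ≥ 2` (here `3j > r ≥ 3`),
a gate reference reads a listed value (invariant) or the junk value `0`.
[cite: Raz2010, Prop. 2.7 (p. 153), proof] -/
private theorem midGood_operand {r : ℕ} (hr : 3 ≤ r) {vals : List (MvPolynomial σ K)}
    (h : MidGood r vals) (u : Operand K σ) {j : ℕ} (hj : r < 3 * j) :
    homogeneousComponent j (u.eval vals) ∈ Ideal.span (midGens r vals) := by
  cases u with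
  | var i =>
    simp only [Operand.eval]
    rw [homogeneousComponent_of_mem (isHomogeneous_X K i), if_neg (by omega)]
    exact Submodule.zero_mem _
  | const c =>
    simp only [Operand.eval]
    rw [homogeneousComponent_of_mem (isHomogeneous_C σ c), if_neg (by omega)]
    exact Submodule.zero_mem _
  | gate i =>
    simp only [Operand.eval]
    rw [List.getD_eq_getElem?_getD]
    cases hi : vals[i]? with
    | none => simp
    | some v => simpa using h v (List.mem_of_getElem? hi) j hj

/-- One gate (the step "`g = g₀ + P · Q`" of Raz 2010, p. 153, in Cauchy-product form): for
`j > 2r/3`, the degree-`j` component of the value of a fan-in-two gate lies in the ideal of the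
middle components of the earlier values — for a sum gate by linearity, for a product gate
`u · w` because in `[uw]_j = ∑_i [u]_i [w]_{j-i}` one of `i`, `j - i` exceeds `r/3`.
[cite: Raz2010, Prop. 2.7 (p. 153), proof] -/
private theorem midGood_gate {r : ℕ} (hr : 3 ≤ r) {vals : List (MvPolynomial σ K)}
    (h : MidGood r vals) {g : Gate K σ} (hg : g.fanIn ≤ 2) {j : ℕ} (hj : 2 * r < 3 * j) :
    homogeneousComponent j (g.eval vals) ∈ Ideal.span (midGens r vals) := by
  cases g with
  | sum args =>
    simp only [Gate.eval]
    rw [map_list_sum, List.map_map]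
    refine list_sum_mem fun p hp => ?_
    obtain ⟨a, -, rfl⟩ := List.mem_map.1 hp
    simp only [Function.comp_apply, map_smul]
    rw [smul_eq_C_mul]
    exact Ideal.mul_mem_left _ _ (midGood_operand hr h a.2 (by omega))
  | prod args =>
    rcases args with _ | ⟨u, _ | ⟨w, _ | ⟨x, rest⟩⟩⟩
    · simp only [Gate.eval, List.map_nil, List.prod_nil]
      rw [homogeneousComponent_of_mem (isHomogeneous_one σ K), if_neg (by omega)]
      exact Submodule.zero_mem _
    · simp only [Gate.eval, List.map_cons, List.map_nil, List.prod_cons, List.prod_nil, mul_one]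
      exact midGood_operand hr h u (by omega)
    · simp only [Gate.eval, List.map_cons, List.map_nil, List.prod_cons, List.prod_nil, mul_one]
      rw [DepthReduction.homogeneousComponent_mul]
      refine Ideal.sum_mem _ fun i hi => ?_
      by_cases hiu : r < 3 * i
      · exact Ideal.mul_mem_right _ _ (midGood_operand hr h u hiu)
      · have hi' := Finset.mem_range.1 hi
        exact Ideal.mul_mem_left _ _ (midGood_operand hr h w (by omega))
    · exact absurd hg (by simp [Gate.fanIn, Gate.args])

/-- Appending the value of one more fan-in-two gate preserves the invariant (its middle
components are new generators, its high components are handled by `midGood_gate`).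
[cite: Raz2010, Prop. 2.7 (p. 153), proof] -/
private theorem midGood_append {r : ℕ} (hr : 3 ≤ r) {vals : List (MvPolynomial σ K)}
    (h : MidGood r vals) {g : Gate K σ} (hg : g.fanIn ≤ 2) :
    MidGood r (vals ++ [g.eval vals]) := by
  have hsub : Ideal.span (midGens r vals) ≤ Ideal.span (midGens r (vals ++ [g.eval vals])) :=
    Ideal.span_mono (midGens_mono r (List.subset_append_left _ _))
  intro v hv j hj
  rw [List.mem_append, List.mem_singleton] at hv
  rcases hv with hv | rfl
  · exact hsub (h v hv j hj)
  · by_cases hmid : 3 * j ≤ 2 * r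
    · exact Ideal.subset_span
        ⟨_, List.mem_append_right _ (List.mem_singleton_self _), j, ⟨hj, hmid⟩, rfl⟩
    · exact hsub (midGood_gate hr h hg (by omega))

/-- The invariant holds for the value list of every fan-in-two gate list (induction along the
fold; Raz's induction on the size of the circuit). [cite: Raz2010, Prop. 2.7 (p. 153), proof] -/
private theorem midGood_gateValues {r : ℕ} (hr : 3 ≤ r) {gs : List (Gate K σ)}
    (hgs : ∀ g ∈ gs, g.fanIn ≤ 2) : MidGood r (gateValues gs) := by
  induction gs using List.reverseRecOn with
  | nil =>
    intro v hv
    simp [gateValues] at hv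
  | append_singleton gs g ih =>
    rw [gateValues_append_singleton]
    exact midGood_append hr (ih fun g' hg' => hgs g' (List.mem_append_left _ hg'))
      (hgs g (List.mem_append_right _ (List.mem_singleton_self _)))

/-- The degree-`r` component of the output of a fan-in-two circuit lies in the ideal of the
middle components of its gate values. [cite: Raz2010, Prop. 2.7 (p. 153), proof] -/
private theorem homogeneousComponent_eval_mem_span {r : ℕ} (hr : 3 ≤ r) {P : ArithCircuit K σ}
    (hP : P.IsFanInTwo) :
    homogeneousComponent r P.eval ∈ Ideal.span (midGens r (gateValues P.gates)) :=
  midGood_operand hr (midGood_gateValues hr hP) P.output (by omega)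

/-- The generators as a finite family indexed by slots `(ℓ, d) ∈ [L] × [0, r]`: the degree-`d`
component of the `ℓ`-th gate value if `d` is a middle degree, else `0` (Raz's "types" of
product gates, proof of Prop. 2.9). [cite: Raz2010, Prop. 2.9 (p. 155), proof] -/
private def slotGen (r : ℕ) (vals : List (MvPolynomial σ K)) (L : ℕ) (t : Fin L × Fin (r + 1)) :
    MvPolynomial σ K :=
  if r < 3 * (t.2 : ℕ) ∧ 3 * (t.2 : ℕ) ≤ 2 * r then homogeneousComponent t.2 (vals.getD t.1 0)
  else 0

/-- Every generator is a slot value (when `L` bounds the number of gate values).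
[cite: Raz2010, Prop. 2.9 (p. 155), proof] -/
private theorem midGens_subset_range {r L : ℕ} {vals : List (MvPolynomial σ K)}
    (hL : vals.length ≤ L) : midGens r vals ⊆ Set.range (slotGen r vals L) := by
  rintro p ⟨v, hv, d, hd, rfl⟩
  obtain ⟨ℓ, hℓ, rfl⟩ := List.getElem_of_mem hv
  refine ⟨(⟨ℓ, by omega⟩, ⟨d, by omega⟩), ?_⟩
  simp only [slotGen]
  rw [if_pos hd, List.getD_eq_getElem?_getD, List.getElem?_eq_getElem hℓ, Option.getD_some]

/-- Degree-`n` component of `p · q` for a form `q` of degree `d ≤ n`: `[p q]_n = [p]_{n-d} q`.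
[folklore] -/
private theorem homogeneousComponent_mul_form {p q : MvPolynomial σ K} {d n : ℕ}
    (hq : q.IsHomogeneous d) (hdn : d ≤ n) :
    homogeneousComponent n (p * q) = homogeneousComponent (n - d) p * q := by
  rw [DepthReduction.homogeneousComponent_mul, Finset.sum_eq_single (n - d)]
  · rw [Nat.sub_sub_self hdn, homogeneousComponent_eq_self hq]
  · intro i hi hne
    have hi' := Finset.mem_range.1 hi
    rw [homogeneousComponent_of_mem hq, if_neg (by omega), mul_zero]
  · intro hnd
    exact absurd (Finset.mem_range.2 (by omega)) hnd

/-- **Raz 2010, Prop. 2.7 (structural core of the normal-depth-4 form).** A form `g` of degree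
`r ≥ 3` computed by a fan-in-two circuit with at most `L` gates is a sum, over the
`L · (r + 1)` slots, of products `A_t · B_t` of polynomials of degree at most `r' = ⌊2r/3⌋`
("`g = ∑ᵢ PᵢQᵢ`, where `Pᵢ, Qᵢ` are homogenous polynomials of degree at most `2r/3`", p. 153;
here `A_t` is the middle component named by the slot and `B_t` the complementary component of
its coefficient in an ideal-membership witness). [cite: Raz2010, Prop. 2.7 (pp. 152–153)] -/
theorem exists_sum_mul_of_circuit {r L : ℕ} (hr : 3 ≤ r) {P : ArithCircuit K σ}
    (hP : P.IsFanInTwo) (hL : P.size ≤ L) {g : MvPolynomial σ K} (hg : P.Computes g)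
    (hhom : g.IsHomogeneous r) :
    ∃ A B : Fin L × Fin (r + 1) → MvPolynomial σ K,
      (∀ t, (A t).totalDegree ≤ 2 * r / 3) ∧ (∀ t, (B t).totalDegree ≤ 2 * r / 3) ∧
        g = ∑ t, A t * B t := by
  classical
  have hmem : g ∈ Ideal.span (Set.range (slotGen r (gateValues P.gates) L)) := by
    have h := homogeneousComponent_eval_mem_span hr hP
    unfold Computes at hg
    rw [hg, homogeneousComponent_eq_self hhom] at h
    refine Ideal.span_mono (midGens_subset_range ?_) h
    rw [gateValues_length]
    exact hL
  obtain ⟨c, hc⟩ := Ideal.mem_span_range_iff_exists_fun.1 hmem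
  refine ⟨slotGen r (gateValues P.gates) L,
    fun t => if r < 3 * (t.2 : ℕ) ∧ 3 * (t.2 : ℕ) ≤ 2 * r then
      homogeneousComponent (r - t.2) (c t) else 0, fun t => ?_, fun t => ?_, ?_⟩
  · simp only [slotGen]
    split_ifs with ht
    · exact (homogeneousComponent_isHomogeneous _ _).totalDegree_le.trans (by omega)
    · simp
  · dsimp only
    split_ifs with ht
    · exact (homogeneousComponent_isHomogeneous _ _).totalDegree_le.trans (by omega)
    · simp
  · calc g = homogeneousComponent r g := (homogeneousComponent_eq_self hhom).symm
      _ = ∑ t, homogeneousComponent r (c t * slotGen r (gateValues P.gates) L t) := by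
          rw [← hc, map_sum]
      _ = _ := Finset.sum_congr rfl fun t _ => ?_
    dsimp only
    by_cases ht : r < 3 * (t.2 : ℕ) ∧ 3 * (t.2 : ℕ) ≤ 2 * r
    · rw [if_pos ht, mul_comm (slotGen r _ L t)]
      refine homogeneousComponent_mul_form ?_ (by omega)
      simp only [slotGen, if_pos ht]
      exact homogeneousComponent_isHomogeneous _ _
    · simp [slotGen, if_neg ht]

end Structure

/-! ### Props. 5.1–5.3: the universal polynomial mapping of degree `2` -/

section Universal

variable {K : Type u} [CommSemiring K]

/-- The monomials of degree at most `e` in `z₁, …, zₙ` (the monomials that may occur in the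
polynomials `Pᵢ, Qᵢ` of degree `≤ r'`; Raz 2010, §5.2: "the labels `y₁, …, y_s` are just the
coefficients of all the monomials in all the polynomials `Pᵢ, Qᵢ`").
[cite: Raz2010, §5.2 (p. 169)] -/
def lowMonomials (n e : ℕ) : Finset (Fin n →₀ ℕ) :=
  (Finset.range (e + 1)).biUnion fun k => (Finset.univ : Finset (Fin n)).finsuppAntidiag k

/-- Membership in `lowMonomials`: degree at most `e`. [cite: Raz2010, §5.2 (p. 169)] -/
theorem mem_lowMonomials {n e : ℕ} {d : Fin n →₀ ℕ} : d ∈ lowMonomials n e ↔ d.degree ≤ e := by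
  simp [lowMonomials, Finsupp.degree_eq_sum]

/-- `C(n+k-1, k) ≤ C(n+e-1, e)` for `k ≤ e` and `n ≥ 1` (both count monomials; pad with `z₁`).
[folklore] -/
private theorem choose_monomials_mono {n k e : ℕ} (hn : 1 ≤ n) (hke : k ≤ e) :
    Nat.choose (n + k - 1) k ≤ Nat.choose (n + e - 1) e := by
  have h1 : n + k - 1 = k + (n - 1) := by omega
  have h2 : n + e - 1 = e + (n - 1) := by omega
  rw [h1, h2, Nat.choose_symm_add, Nat.choose_symm_add]
  exact Nat.choose_le_choose (n - 1) (by omega)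

/-- There are at most `(e + 1) · C(n+e-1, e)` monomials of degree `≤ e` in `n ≥ 1` variables
(crude form of `C(n+e, e)`; Raz 2010, §5.1: `C(n+r-1, r)` monomials of degree exactly `r`).
[cite: Raz2010, §5.1 (p. 168)] -/
theorem card_lowMonomials_le {n e : ℕ} (hn : 1 ≤ n) :
    (lowMonomials n e).card ≤ (e + 1) * Nat.choose (n + e - 1) e := by
  unfold lowMonomials
  refine Finset.card_biUnion_le.trans ?_
  calc ∑ k ∈ Finset.range (e + 1), ((Finset.univ : Finset (Fin n)).finsuppAntidiag k).card
      = ∑ k ∈ Finset.range (e + 1), Nat.choose (n + k - 1) k := by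
        refine Finset.sum_congr rfl fun k _ => ?_
        rw [Finset.card_finsuppAntidiag_nat_eq_choose, Finset.card_univ, Fintype.card_fin]
    _ ≤ ∑ _k ∈ Finset.range (e + 1), Nat.choose (n + e - 1) e :=
        Finset.sum_le_sum fun k hk =>
          choose_monomials_mono hn (Nat.lt_succ_iff.1 (Finset.mem_range.1 hk))
    _ = (e + 1) * Nat.choose (n + e - 1) e := by simp

/-- **Raz's universal polynomial** (2010, §5.2): `U = ∑_t (∑_b y_{t,0,b} z^b)(∑_b y_{t,1,b} z^b)`,
a polynomial in `z₁, …, zₙ` whose coefficients are polynomials in the labels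
`y ∈ S × {0,1} × {monomials of degree ≤ e}` — the output of the normal-depth-4 universal
circuit-graph with `S` product gates above the leaves, as a function of the labels of the
edges leaving them. [cite: Raz2010, §5.2 (pp. 168–169)] -/
def universalPoly (n e : ℕ) (S : Type w) [Fintype S] :
    MvPolynomial (Fin n) (MvPolynomial (S × Bool × ↥(lowMonomials n e)) K) :=
  ∑ t : S, (∑ b : ↥(lowMonomials n e), monomial (b : Fin n →₀ ℕ) (X (t, false, b))) *
    (∑ b : ↥(lowMonomials n e), monomial (b : Fin n →₀ ℕ) (X (t, true, b)))

/-- **Raz 2010, Prop. 5.2**: the coefficients of `U`, i.e. the coordinates of `Γ_G`, are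
polynomials of degree (at most) `2` in the labels. [cite: Raz2010, Prop. 5.2 (p. 169)] -/
theorem totalDegree_coeff_universalPoly_le (n e : ℕ) (S : Type w) [Fintype S]
    (M : Fin n →₀ ℕ) : (coeff M (universalPoly (K := K) n e S)).totalDegree ≤ 2 := by
  classical
  have h1 : ∀ (t : S) (c : Bool) (N : Fin n →₀ ℕ),
      (coeff N (∑ b : ↥(lowMonomials n e), monomial (b : Fin n →₀ ℕ)
        (X (t, c, b) : MvPolynomial (S × Bool × ↥(lowMonomials n e)) K))).totalDegree ≤ 1 := by
    intro t c N
    rw [coeff_sum]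
    refine totalDegree_finsetSum_le fun b _ => ?_
    rw [coeff_monomial]
    split_ifs
    · exact DepthReduction.totalDegree_X_le _
    · simp
  unfold universalPoly
  rw [coeff_sum]
  refine totalDegree_finsetSum_le fun t _ => ?_
  rw [coeff_mul]
  refine totalDegree_finsetSum_le fun x _ => ?_
  exact (totalDegree_mul _ _).trans (add_le_add (h1 t false x.1) (h1 t true x.2))

/-- A polynomial of degree `≤ e` is the sum of its monomials of degree `≤ e`. [folklore] -/
private theorem sum_lowMonomials_monomial_coeff {n e : ℕ} (p : MvPolynomial (Fin n) K)
    (hp : p.totalDegree ≤ e) :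
    ∑ b : ↥(lowMonomials n e), monomial (b : Fin n →₀ ℕ) (coeff (b : Fin n →₀ ℕ) p) = p := by
  classical
  rw [Finset.sum_coe_sort (lowMonomials n e) fun b => monomial b (coeff b p)]
  symm
  conv_lhs => rw [p.as_sum]
  refine Finset.sum_subset (fun v hv => mem_lowMonomials.2 ?_) fun v _ hv => ?_
  · rw [Finsupp.degree_apply]
    exact (le_totalDegree hv).trans hp
  · rw [notMem_support_iff.1 hv, map_zero]

/-- **Raz 2010, Prop. 5.1** (labels ↦ polynomial): evaluating the labels of `U` at the
coefficient vectors of polynomials `A_t, B_t` of degree `≤ e` yields the polynomial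
`∑_t A_t B_t` (the circuit with these labels computes `g = ∑ PᵢQᵢ`).
[cite: Raz2010, Prop. 5.1 (p. 169)] -/
theorem map_eval_universalPoly {n e : ℕ} {S : Type w} [Fintype S]
    (A B : S → MvPolynomial (Fin n) K) (hA : ∀ t, (A t).totalDegree ≤ e)
    (hB : ∀ t, (B t).totalDegree ≤ e) :
    MvPolynomial.map (eval fun v : S × Bool × ↥(lowMonomials n e) =>
        coeff (v.2.2 : Fin n →₀ ℕ) (bif v.2.1 then B v.1 else A v.1))
      (universalPoly n e S) = ∑ t, A t * B t := by
  unfold universalPoly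
  rw [map_sum]
  refine Finset.sum_congr rfl fun t _ => ?_
  rw [map_mul, map_sum, map_sum]
  simp only [map_monomial, eval_X, cond_true, cond_false]
  rw [sum_lowMonomials_monomial_coeff (A t) (hA t), sum_lowMonomials_monomial_coeff (B t) (hB t)]

/-- **Raz 2010, Prop. 5.1** (labels ↦ coefficients): coefficient by coefficient,
"`Γ_G(α₁, …, α_s) = H(g)`" for `g = ∑_t A_t B_t`. [cite: Raz2010, Prop. 5.1 (p. 169)] -/
theorem eval_coeff_universalPoly {n e : ℕ} {S : Type w} [Fintype S]
    (A B : S → MvPolynomial (Fin n) K) (hA : ∀ t, (A t).totalDegree ≤ e)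
    (hB : ∀ t, (B t).totalDegree ≤ e) (M : Fin n →₀ ℕ) :
    eval (fun v : S × Bool × ↥(lowMonomials n e) =>
        coeff (v.2.2 : Fin n →₀ ℕ) (bif v.2.1 then B v.1 else A v.1))
      (coeff M (universalPoly n e S)) = coeff M (∑ t, A t * B t) := by
  rw [← map_eval_universalPoly A B hA hB, coeff_map]

/-- **Raz 2010, Prop. 5.3 (with Props. 2.7, 2.9, 5.1, 5.2): the universal degree-`2` map.**
For `3 ≤ r`, `1 ≤ n` and every gate budget `L` there is a polynomial mapping
`Γ : K^N → K^m`, `m = C(n+r-1, r)`, of degree `2`, with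
`N ≤ 4 · C(n+r'-1, r') · r³ · (L + n)`, `r' = ⌊2r/3⌋`, whose image contains the coefficient
vector `H(g)` of every form `g` of degree `r` in `z₁, …, zₙ` of fan-in-two circuit
complexity at most `L`. [cite: Raz2010, Prop. 5.3 (p. 170)] -/
theorem exists_universal_map (K : Type u) [CommSemiring K] {n r : ℕ} (hr : 3 ≤ r)
    (hn : 1 ≤ n) (L : ℕ) :
    ∃ (N : ℕ) (Γ : Fin (Nat.choose (n + r - 1) r) → MvPolynomial (Fin N) K),
      N ≤ 4 * Nat.choose (n + 2 * r / 3 - 1) (2 * r / 3) * r ^ 3 * (L + n) ∧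
      (∀ j, (Γ j).totalDegree ≤ 2) ∧
      ∀ g : MvPolynomial (Fin n) K, g.IsHomogeneous r → complexity g ≤ L →
        lexCoeffs n r g ∈ Set.range (polyMapEval Γ) := by
  classical
  set e := 2 * r / 3 with he
  let V := (Fin L × Fin (r + 1)) × Bool × ↥(lowMonomials n e)
  let φ : V ≃ Fin (Fintype.card V) := Fintype.equivFin V
  let Γ₀ : Fin (Nat.choose (n + r - 1) r) → MvPolynomial V K := fun j =>
    coeff (lexMonomial n r j) (universalPoly n e (Fin L × Fin (r + 1)))
  refine ⟨Fintype.card V, fun j => rename φ (Γ₀ j), ?_, fun j => ?_, fun g hg hgL => ?_⟩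
  · have hcard : Fintype.card V = L * (r + 1) * (2 * (lowMonomials n e).card) := by
      simp only [V, Fintype.card_prod, Fintype.card_fin, Fintype.card_bool, Fintype.card_coe]
    rw [hcard]
    calc L * (r + 1) * (2 * (lowMonomials n e).card)
        ≤ L * (2 * r) * (2 * (r * Nat.choose (n + e - 1) e)) := by
          have h1 : r + 1 ≤ 2 * r := by omega
          have h2 : (lowMonomials n e).card ≤ r * Nat.choose (n + e - 1) e :=
            (card_lowMonomials_le hn).trans (Nat.mul_le_mul_right _ (by omega))
          gcongr
      _ = 4 * Nat.choose (n + e - 1) e * (r ^ 2 * L) := by ring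
      _ ≤ 4 * Nat.choose (n + e - 1) e * (r ^ 3 * (L + n)) :=
          Nat.mul_le_mul_left _ (Nat.mul_le_mul (Nat.pow_le_pow_right (by omega) (by norm_num))
            (Nat.le_add_right L n))
      _ = 4 * Nat.choose (n + e - 1) e * r ^ 3 * (L + n) := by ring
  · exact (totalDegree_rename_le _ _).trans (totalDegree_coeff_universalPoly_le _ _ _ _)
  · obtain ⟨P, hP2, hPg, hPs⟩ := ArithCircuit.exists_computes_size_eq_complexity g
    obtain ⟨A, B, hA, hB, hgAB⟩ :=
      exists_sum_mul_of_circuit hr hP2 (hPs.symm ▸ hgL : P.size ≤ L) hPg hg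
    let y : V → K := fun v => coeff (v.2.2 : Fin n →₀ ℕ) (bif v.2.1 then B v.1 else A v.1)
    refine ⟨y ∘ φ.symm, ?_⟩
    rw [polyMapEval_rename]
    have hy : (y ∘ φ.symm) ∘ φ = y := by
      funext v
      simp
    rw [hy]
    funext j
    rw [polyMapEval_apply, lexCoeffs_apply, hgAB]
    exact eval_coeff_universalPoly A B hA hB _

end Universal

/-! ### Prop. 5.6 and Cor. 5.7 -/

section Transfer

variable {F : Type u} [CommSemiring F] {G : Type w} [CommSemiring G] {n r : ℕ}

/-- `f̃` is defined over the prime field of its data: mapping the coefficients of `f` maps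
those of `f̃` (Raz 2010, proof of Prop. 5.6: "as for `f̃`, by its definition, its coefficients
are just corresponding coefficients from the polynomials `f₁, …, f_m`").
[cite: Raz2010, Prop. 5.6 (p. 172), proof] -/
theorem map_razTilde (φ : F →+* G) (f : Fin (Nat.choose (n + r - 1) r) → MvPolynomial (Fin n) F) :
    MvPolynomial.map φ (razTilde f) = razTilde fun i => MvPolynomial.map φ (f i) := by
  unfold razTilde
  simp only [map_sum, map_mul, map_rename, map_monomial, map_one]

/-- `f̃|_a` is a projection of `f̃` (substitute the constants `aᵢ` for the `xᵢ`), so that a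
circuit for `f̃` gives one of the same size for `f̃|_a` (Raz 2010, proof of Prop. 5.6: "By
substituting in this circuit `x₁ = a₁, …, xₙ = aₙ` … we obtain an arithmetic circuit of size
`s'` for the polynomial `f̃|_a`"). [cite: Raz2010, Prop. 5.6 (pp. 171–172), proof] -/
theorem isProjection_razTildeAt (f : Fin (Nat.choose (n + r - 1) r) → MvPolynomial (Fin n) F)
    (a : Fin n → F) : IsProjection (razTildeAt f a) (razTilde f) := by
  refine ⟨Sum.elim (C ∘ a) X, fun v => ?_, rfl⟩
  rcases v with i | i
  · exact Or.inr ⟨a i, rfl⟩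
  · exact Or.inl ⟨i, rfl⟩

end Transfer

/-- **Raz 2010, Corollary 5.7** — discharge of the named fact `Raz2010_cor_5_7`, with the
constant `c = 4`: if over some extension `G ⊇ F` the mapping `f` is `(s, 2)`-elusive and
`3 ≤ r ≤ n`, then `s ≤ 4 · C(n+r'-1, r') · r³ · (L(f̃) + n)`. Proof as printed (Prop. 5.6 from
Props. 5.3, 5.4; Cor. 5.7 from Prop. 5.6): were `s` larger, the universal degree-`2` map `Γ`
over `G` in `N ≤ 4 · C(n+r'-1,r') · r³ · (L(f̃) + n) ≤ s` labels (`exists_universal_map`)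
would contain in its image every `f(a) = H(f̃|_a)` (Prop. 5.4, `lexCoeffs_razTildeAt`), since
`L_G(f̃|_a) ≤ L_G(f̃) ≤ L_F(f̃)` (`isProjection_razTildeAt`, `complexity_map_le`), contradicting
elusiveness (`IsElusive.anti_left`). The field `F` is the (implicit) section parameter of the
fact; no hypothesis is assumed. [cite: Raz2010, Cor. 5.7 (p. 172); Prop. 5.6 (pp. 171–172)] -/
theorem Raz2010_cor_5_7_holds {F : Type u} [Field F] : Raz2010_cor_5_7 F := by
  rintro r s f ⟨n₁, hpar⟩ ⟨n₂, hel⟩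
  refine ⟨4, max n₁ n₂, fun n hn => ?_⟩
  obtain ⟨h3, hrn, -⟩ := hpar n (le_of_max_le_left hn)
  obtain ⟨G, _, _, hG⟩ := hel n (le_of_max_le_right hn)
  by_contra hlt
  rw [not_le] at hlt
  obtain ⟨N, Γ, hN, hdeg, huniv⟩ :=
    exists_universal_map G h3 (by omega : 1 ≤ n) (complexity (razTilde (n := n) (r := r n) (f n)))
  refine (hG.anti_left (hN.trans hlt.le)) Γ hdeg ?_
  rintro _ ⟨a, rfl⟩
  rw [← lexCoeffs_razTildeAt]
  refine huniv _ (isHomogeneous_razTildeAt _ a) ?_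
  calc complexity (razTildeAt (fun i => MvPolynomial.map (algebraMap F G) (f n i)) a)
      ≤ complexity (razTilde fun i => MvPolynomial.map (algebraMap F G) (f n i)) :=
        complexity_le_of_isProjection (isProjection_razTildeAt _ a)
    _ = complexity (MvPolynomial.map (algebraMap F G) (razTilde (n := n) (r := r n) (f n))) := by
        rw [map_razTilde]
    _ ≤ complexity (razTilde (n := n) (r := r n) (f n)) := ArithCircuit.complexity_map_le _ _

end Literature.Computability.AlgebraicComplexity

end
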